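import Literature.Topology.FourManifolds.TraceNormalStraighten
import Literature.Topology.FourManifolds.TracePolarTwist
import Literature.Topology.FourManifolds.PairEndgame
import Literature.Topology.FourManifolds.CircleDiffeotopyProofs
import Literature.Topology.FourManifolds.CollarTheorem
import Literature.Topology.FourManifolds.DiffeotopyProofs
import HarnessLib

/-!
# Boundary diffeomorphisms permuting the trace circles of the saddles extend over the
# three-manifold

Topic `Literature/Topology/FourManifolds`; last file of the series `TracePolarModel.lean`, …,
`TraceNormalStraighten.lean`, `TracePolarTwist.lean` (support for the Torelli half of Griffiths'
handlebody theorem, `stmt-SmoothPoincare4-15190`).  Everything here is **proved**; no named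
facts.

**Theorem** (`BasinPair.SaddleData.diffeoExtends_of_traceOf`).  Let `W` be a compact
`3`-manifold with boundary, `P` a pair of basin settings on `W` (one Morse function `g` on
`(W; ∅, ∂W)`, two gradient-like fields `ξ_A`, `ξ_B` with the same unique minimum) with saddle
data `Q` all of whose boxes have index `1` (e.g. `W` a genus-`g` handlebody, `ξ_A = ξ_B`, the
saddles the `1`-handles).  Then **every diffeomorphism `χ` of `∂W` which carries the `ξ_A`-trace
circle of each saddle `s` onto the `ξ_B`-trace circle of `σ s` extends to a diffeomorphism of
`W`.**  In handle language: a diffeomorphism of the boundary of a handlebody which permutes the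
belt circles of the `1`-handles of a handle decomposition (as a set of unparametrised circles)
extends over the handlebody — the classical "standard form near the meridians ⇒ extension"
step of Griffiths (1964), §§3–6, with the standardisation supplied by isotopies.

Proof.  Extendable boundary diffeomorphisms form a group containing every diffeomorphism
diffeotopic to the identity (collar theorem, `BoundaryData.diffeoExtends_of_isDiffeotopicToId_holds`)
and every diffeomorphism rigid at the saddles (two-field endgame, `PairEndgame.lean`).  Re-choose
the `B`-boxes by reflections so that every circle map of `χ` is isotopic to the identity
(Hirsch, Thm. 8.3.3, `Diffeomorph.isIsotopic_refl_or_circleConj_holds`; `TracePolarTwist.lean`),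
straighten `χ` on the circles by an ambient isotopy `Ψ` (`TraceCircleStraighten.lean`),
re-choose the `B`-boxes by inversions so that `Ψ₁⁻¹ ∘ χ` preserves the sides of every circle
(`CircleGermStraightLine.lean`), straighten near the circles by an ambient isotopy `Φ`
(`TraceNormalStraighten.lean`); then `Φ₁⁻¹ ∘ Ψ₁⁻¹ ∘ χ` is rigid and extends, and so does
`χ = Ψ₁ ∘ Φ₁ ∘ (Φ₁⁻¹ ∘ Ψ₁⁻¹ ∘ χ)`.

## References

* H. B. Griffiths, *Automorphisms of a 3-dimensional handlebody*, Abh. Math. Sem. Univ. Hamburg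
  26 (1964), §§3–6. [GriffithsHB1964Handlebody]
* M. W. Hirsch, *Differential Topology*, GTM 33 (1976), Ch. 8 §1 Thm. 1.3, §2 (proof of
  Thm. 2.3), §3 Thm. 3.3. [HirschDT1976]
* J. Milnor, *Lectures on the h-cobordism theorem* (1965), Def. 3.1, Thm. 4.1. [MilnorHCobordism1965]
-/

open scoped Manifold ContDiff Topology RealInnerProductSpace
open Set Function Filter Metric

noncomputable section

namespace Literature.Topology.FourManifolds

open Cobordism FourManifolds.Flow TracePolar CircleGerm

universe u

namespace BasinPair

namespace SaddleData

attribute [local instance] fact_finrank_euclideanSpace_succ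

variable {W : Type u} [TopologicalSpace W] [T2Space W] [SecondCountableTopology W]
  [CompactSpace W] [ChartedSpace (EuclideanHalfSpace (2 + 1)) W] [IsManifold (𝓡∂ (2 + 1)) ∞ W]
  {g : W → ℝ} {ξA ξB : Π x : W, TangentSpace (𝓡∂ (2 + 1)) x} {P : BasinPair g ξA ξB}
  {Q : P.SaddleData} [Nonempty (BoundaryManifold.boundaryData 2 W).carrier]

/-- Local notation for the model plane. -/
local notation "E2" => EuclideanSpace ℝ (Fin 2)

/-! ### Postcomposing a circle isotopy with a diffeomorphism -/

omit [Nonempty (BoundaryManifold.boundaryData 2 W).carrier] in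
/-- **A smooth isotopy of maps into `N` followed by a diffeomorphism of `N` is a smooth isotopy.** [cite: HirschDT1976, Ch. 8 §1] -/
def _root_.Literature.Topology.FourManifolds.SmoothIsotopy.postcomp
    {f₀ f₁ : Metric.sphere (0 : E2) 1 → Metric.sphere (0 : E2) 1} (F : SmoothIsotopy (𝓡 1) (𝓡 1) f₀ f₁)
    (e : Metric.sphere (0 : E2) 1 ≃ₘ⟮𝓡 1, 𝓡 1⟯ Metric.sphere (0 : E2) 1) :
    SmoothIsotopy (𝓡 1) (𝓡 1) (e ∘ f₀) (e ∘ f₁) where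
  toFun t := e ∘ F.toFun t
  contMDiff := e.contMDiff.comp F.contMDiff
  isSmoothEmbedding t := (F.isSmoothEmbedding t).diffeomorph_comp e
  map_zero := by rw [F.map_zero]
  map_one := by rw [F.map_one]

omit [Nonempty (BoundaryManifold.boundaryData 2 W).carrier] in
/-- **A circle diffeomorphism isotopic to complex conjugation, followed by complex conjugation,
is isotopic to the identity.** [cite: HirschDT1976, Ch. 8 §3, Thm. 3.3] -/
theorem isIsotopic_trans_circleConj_refl {φ : Metric.sphere (0 : E2) 1 ≃ₘ⟮𝓡 1, 𝓡 1⟯ Metric.sphere (0 : E2) 1}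
    (h : Diffeomorph.IsIsotopic φ circleConj) :
    Diffeomorph.IsIsotopic (φ.trans circleConj) (Diffeomorph.refl (𝓡 1) (Metric.sphere (0 : E2) 1) ∞) := by
  obtain ⟨F⟩ := h
  refine ⟨?_⟩
  have h0 : (circleConj : _ → _) ∘ (φ : _ → _) = ⇑(φ.trans circleConj) := rfl
  have h1 : (circleConj : _ → _) ∘ (circleConj : Metric.sphere (0 : E2) 1 → _) =
      ⇑(Diffeomorph.refl (𝓡 1) (Metric.sphere (0 : E2) 1) ∞) := by
    funext y; simp
  rw [← h0, ← h1]
  exact F.postcomp circleConj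

/-! ### The circle maps of the twisted data -/

section TwistCircle

variable (hk : ∀ s, (Q.DA s).k = 1) (χ : (𝓡∂ (2 + 1)).boundary W ≃ₘ⟮𝓡 2, 𝓡 2⟯ (𝓡∂ (2 + 1)).boundary W)
  (hχ : ∀ s y, χ y ∈ P.B.traceOf (Q.σ s) ↔ y ∈ P.A.traceOf s) (a b : SaddlePt 2 g → Bool)

omit [Nonempty (BoundaryManifold.boundaryData 2 W).carrier] in
include hk in
/-- The index hypothesis for the twisted data (the `A`-boxes are unchanged). [folklore] -/
theorem hk_twistB : ∀ s, ((Q.twistB a b).DA s).k = 1 := hk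

omit [Nonempty (BoundaryManifold.boundaryData 2 W).carrier] in
/-- Complex conjugation negates the last coordinate: it is `planeRefl true` on the circle. [folklore] -/
theorem coe_circleConj_eq_planeRefl (y : Metric.sphere (0 : E2) 1) : ((circleConj y : Metric.sphere (0 : E2) 1) : E2) = planeRefl true (y : E2) := by
  ext i
  rw [coe_circleConj_apply]
  fin_cases i <;> simp [planeRefl, boolSign]

omit [Nonempty (BoundaryManifold.boundaryData 2 W).carrier] in
/-- On unit vectors `planeSym a' b'` is the reflection `planeRefl b'`. [folklore] -/
theorem planeSym_of_norm_eq_one (a' b' : Bool) {u : E2} (hu : ‖u‖ = 1) : planeSym a' b' u = planeRefl b' u := by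
  rw [planeSym_def, planeInv_of_norm_eq_one a' (by rw [norm_planeRefl]; exact hu)]

/-- **The circle maps of the twisted data are the old ones followed by the reflections**:
in coordinates, `planeRefl (b (σ s))` of the old value. [folklore] -/
theorem coe_circleDiffeo_twistB (s : SaddlePt 2 g) (u : Metric.sphere (0 : E2) 1) :
    (((Q.twistB a b).circleDiffeo (hk_twistB hk a b) χ hχ s u : Metric.sphere (0 : E2) 1) : E2) =
      planeRefl (b (Q.σ s)) (Q.circleDiffeo hk χ hχ s u : E2) := by
  rw [coe_circleDiffeo, coe_circleDiffeo]
  have hmem : χ (Q.pol s u) ∈ Q.swap.polSource (Q.σ s) := (apply_pol_mem hk hχ s u).2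
  have h1 : (Q.twistB a b).pol s u = Q.pol s u := rfl
  rw [h1, show (Q.twistB a b).σ s = Q.σ s from rfl, twistB_swap_polInv (k_swap_eq_one Q hk _) hmem]
  exact planeSym_of_norm_eq_one _ _ (norm_circleFun hk hχ s u)

/-- The circle maps of the twisted data: the old one where `b (σ s) = false`, the old one
followed by complex conjugation where `b (σ s) = true`. [folklore] -/
theorem circleDiffeo_twistB_eq (s : SaddlePt 2 g) :
    (Q.twistB a b).circleDiffeo (hk_twistB hk a b) χ hχ s =
      if b (Q.σ s) then (Q.circleDiffeo hk χ hχ s).trans circleConj else Q.circleDiffeo hk χ hχ s := by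
  apply Diffeomorph.ext
  intro u
  apply Subtype.ext
  rw [coe_circleDiffeo_twistB hk χ hχ a b s u]
  cases hb : b (Q.σ s)
  · simp only [Bool.false_eq_true, if_false]
    ext i; fin_cases i <;> simp [planeRefl, boolSign]
  · simp only [if_true]
    exact (coe_circleConj_eq_planeRefl (Q.circleDiffeo hk χ hχ s u)).symm

end TwistCircle

/-! ### The permutation theorem -/

omit [Nonempty (BoundaryManifold.boundaryData 2 W).carrier] in
/-- **Trace bookkeeping**: a bijection of `∂W` under which the set of `ξ_B`-traces is invariant
preserves membership in it. [folklore] -/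
theorem mem_traces_iff_of_image_eq {ψ : (𝓡∂ (2 + 1)).boundary W → (𝓡∂ (2 + 1)).boundary W} (hinj : Injective ψ)
    (h1 : ∀ y, y ∈ P.B.traces → ψ y ∈ P.B.traces) (h2 : ∀ y', y' ∈ P.B.traces → ∃ y ∈ P.B.traces, ψ y = y')
    (y : (𝓡∂ (2 + 1)).boundary W) : ψ y ∈ P.B.traces ↔ y ∈ P.B.traces := by
  refine ⟨fun hy => ?_, h1 y⟩
  obtain ⟨y₀, hy₀, he⟩ := h2 _ hy
  rwa [← hinj he]

variable (Q) in
omit [Nonempty (BoundaryManifold.boundaryData 2 W).carrier] in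
/-- **A boundary diffeomorphism carrying the `ξ_A`-trace circle of every saddle onto the
`ξ_B`-trace circle of the corresponding saddle carries `ξ_A`-traces to `ξ_B`-traces.** [folklore] -/
theorem mem_traces_iff_of_traceOf {χ : (𝓡∂ (2 + 1)).boundary W → (𝓡∂ (2 + 1)).boundary W}
    (hχ : ∀ s y, χ y ∈ P.B.traceOf (Q.σ s) ↔ y ∈ P.A.traceOf s) (y : (𝓡∂ (2 + 1)).boundary W) :
    χ y ∈ P.B.traces ↔ y ∈ P.A.traces := by
  rw [BasinSetting.mem_traces_iff_exists_traceOf, BasinSetting.mem_traces_iff_exists_traceOf]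
  constructor
  · rintro ⟨s', hs'⟩
    refine ⟨Q.σ.symm s', (hχ _ y).1 ?_⟩
    rwa [Q.σ.apply_symm_apply]
  · rintro ⟨s, hs⟩
    exact ⟨Q.σ s, (hχ s y).2 hs⟩

/-- **Reflections making the circle maps isotopic to the identity**: for some choice of
reflections of the `B`-boxes every circle map of `χ` for the twisted data is isotopic to the
identity (Hirsch, Thm. 8.3.3: each circle map is isotopic to the identity or to complex
conjugation). [cite: HirschDT1976, Ch. 8 §3, Thm. 3.3] -/
theorem exists_twistB_isIsotopic_refl (hk : ∀ s, (Q.DA s).k = 1)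
    (χ : (𝓡∂ (2 + 1)).boundary W ≃ₘ⟮𝓡 2, 𝓡 2⟯ (𝓡∂ (2 + 1)).boundary W)
    (hχ : ∀ s y, χ y ∈ P.B.traceOf (Q.σ s) ↔ y ∈ P.A.traceOf s) :
    ∃ b : SaddlePt 2 g → Bool, ∀ s, Diffeomorph.IsIsotopic
      ((Q.twistB (fun _ => false) b).circleDiffeo (hk_twistB hk (fun _ => false) b) χ hχ s)
      (Diffeomorph.refl (𝓡 1) (Metric.sphere (0 : E2) 1) ∞) := by
  classical
  obtain ⟨b, hb⟩ : ∃ b : SaddlePt 2 g → Bool, ∀ s, b (Q.σ s) = true ↔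
      ¬ Diffeomorph.IsIsotopic (Q.circleDiffeo hk χ hχ s) (Diffeomorph.refl (𝓡 1) (Metric.sphere (0 : E2) 1) ∞) :=
    ⟨fun s' => decide (¬ Diffeomorph.IsIsotopic (Q.circleDiffeo hk χ hχ (Q.σ.symm s'))
      (Diffeomorph.refl (𝓡 1) (Metric.sphere (0 : E2) 1) ∞)), fun s => by simp⟩
  refine ⟨b, fun s => ?_⟩
  rw [circleDiffeo_twistB_eq hk χ hχ (fun _ => false) b s]
  by_cases h : Diffeomorph.IsIsotopic (Q.circleDiffeo hk χ hχ s) (Diffeomorph.refl (𝓡 1) (Metric.sphere (0 : E2) 1) ∞)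
  · have hbs : b (Q.σ s) = false := by
      cases h' : b (Q.σ s)
      · rfl
      · exact absurd h ((hb s).1 h')
    rw [hbs]; simpa using h
  · rw [(hb s).2 h]; simp only [if_true]
    rcases Diffeomorph.isIsotopic_refl_or_circleConj_holds (Q.circleDiffeo hk χ hχ s) with h' | h'
    · exact absurd h' h
    · exact isIsotopic_trans_circleConj_refl h'

/-- **Side signs of a map which is the identity in flow-polar coordinates on the trace circles**:
at every saddle the germ has a nonvanishing, hence constant, sign `⟪DF_s(z) z, z⟫`. [cite: HirschDT1976, Ch. 4 §5] -/
theorem germ_sign_dichotomy (hk : ∀ s, (Q.DA s).k = 1)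
    (χ : (𝓡∂ (2 + 1)).boundary W ≃ₘ⟮𝓡 2, 𝓡 2⟯ (𝓡∂ (2 + 1)).boundary W)
    (hC : ∀ s (u : E2), ‖u‖ = 1 → χ (Q.pol s u) = Q.swap.pol (Q.σ s) u) (s : SaddlePt 2 g) :
    (∀ z : E2, ‖z‖ = 1 → 0 < ⟪fderiv ℝ (Q.germ χ s) z z, z⟫) ∨
      (∀ z : E2, ‖z‖ = 1 → ⟪fderiv ℝ (Q.germ χ s) z z, z⟫ < 0) := by
  have hdom : IsOpen (Q.germDom χ s) := isOpen_germDom hk s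
  have hsub : Metric.sphere (0 : E2) 1 ⊆ Q.germDom χ s := fun z hz => (germ_of_norm_eq_one hk hC s (by simpa using hz)).2
  have hP : ContDiffOn ℝ ∞ (Q.germ χ s) (Q.germDom χ s) := contDiffOn_germ hk s
  -- the sign never vanishes: `polInv_s ∘ χ⁻¹ ∘ pol'_{σ s}` is a differentiable left inverse
  have hne : ∀ z : E2, ‖z‖ = 1 → ⟪fderiv ℝ (Q.germ χ s) z z, z⟫ ≠ 0 := by
    intro z hz
    have hk' := k_swap_eq_one Q hk (Q.σ s)
    have hzT : z ∈ Q.polTarget := Q.mem_polTarget_of_norm_eq_one hz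
    obtain ⟨-, hzdom⟩ := germ_of_norm_eq_one hk hC s hz
    have hD : HasFDerivAt (Q.germ χ s) (fderiv ℝ (Q.germ χ s) z) z :=
      ((hP.contDiffAt (hdom.mem_nhds hzdom)).differentiableAt (by simp)).hasFDerivAt
    set G : E2 → E2 := fun w => Q.polInv s (χ.symm (Q.swap.pol (Q.σ s) w)) with hG
    have hGP : ∀ᶠ w in 𝓝 z, G (Q.germ χ s w) = w := by
      filter_upwards [hdom.mem_nhds hzdom] with w hw
      show Q.polInv s (χ.symm (Q.swap.pol (Q.σ s) (Q.swap.polInv (Q.σ s) (χ (Q.pol s w))))) = w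
      rw [pol_polInv hk' hw.2, χ.symm_apply_apply, polInv_pol (hk s) hw.1]
    have hGdiff : ContMDiffAt 𝓘(ℝ, E2) 𝓘(ℝ, E2) ∞ G z := by
      have h1 : ContMDiffAt 𝓘(ℝ, E2) (𝓡 2) ∞ (fun w => χ.symm (Q.swap.pol (Q.σ s) w)) z :=
        χ.symm.contMDiff.contMDiffAt.comp z (contMDiffAt_pol hk' hzT)
      have h2 : χ.symm (Q.swap.pol (Q.σ s) z) ∈ Q.polSource s := by
        rw [← hC s z hz, χ.symm_apply_apply]; exact pol_mem_polSource (hk s) hzT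
      exact ContMDiffAt.comp (I' := 𝓡 2) (f := fun w => χ.symm (Q.swap.pol (Q.σ s) w)) z (contMDiffAt_polInv (hk s) h2) h1
    have hGd : HasFDerivAt G (fderiv ℝ G z) z :=
      ((contMDiffAt_iff_contDiffAt.1 hGdiff).differentiableAt (by simp)).hasFDerivAt
    exact inner_fderiv_ne_zero_of_leftInverse (fun w hw => (germ_of_norm_eq_one hk hC s hw).1) hz hD hGd hGP
  rcases inner_fderiv_pos_or_neg hdom hsub (hP.of_le (by norm_cast)) (fun z hz => hne z (by simpa using hz)) with h | h
  · exact Or.inl fun z hz => h z (by simpa using hz)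
  · exact Or.inr fun z hz => h z (by simpa using hz)

/-- **Extension of a boundary diffeomorphism which is the identity in flow-polar coordinates on
the trace circles** (and carries `ξ_A`-traces to `ξ_B`-traces): invert the `B`-boxes where the
side sign is negative, straighten near the circles (`TraceNormalStraighten.lean`), extend the
rigid remainder (`PairEndgame.lean`) and the isotopy (collar theorem). [cite: GriffithsHB1964Handlebody, §§3–6] [cite: HirschDT1976, Ch. 8 §1 Thm. 1.3, §2] -/
theorem diffeoExtends_of_pol_eq_on_circles (Q : P.SaddleData) (hk : ∀ s, (Q.DA s).k = 1)
    (χ : (𝓡∂ (2 + 1)).boundary W ≃ₘ⟮𝓡 2, 𝓡 2⟯ (𝓡∂ (2 + 1)).boundary W)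
    (hC : ∀ s (u : E2), ‖u‖ = 1 → χ (Q.pol s u) = Q.swap.pol (Q.σ s) u)
    (hχtr : ∀ y, χ y ∈ P.B.traces ↔ y ∈ P.A.traces) :
    (BoundaryManifold.boundaryData 2 W).DiffeoExtends χ := by
  classical
  -- Step 1: inversions making `χ` side-preserving
  obtain ⟨a, ha⟩ : ∃ a : SaddlePt 2 g → Bool, ∀ s, a (Q.σ s) = true ↔
      ∀ z : E2, ‖z‖ = 1 → ⟪fderiv ℝ (Q.germ χ s) z z, z⟫ < 0 :=
    ⟨fun s' => decide (∀ z : E2, ‖z‖ = 1 → ⟪fderiv ℝ (Q.germ χ (Q.σ.symm s')) z z, z⟫ < 0), fun s => by simp⟩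
  set Q₂ : P.SaddleData := Q.twistB a (fun _ => false) with hQ₂
  have hk₂ : ∀ s, (Q₂.DA s).k = 1 := hk
  have hC₂ : ∀ s (u : E2), ‖u‖ = 1 → χ (Q₂.pol s u) = Q₂.swap.pol (Q₂.σ s) u := by
    intro s u hu
    have hu' : u ∈ Q.polTarget := Q.mem_polTarget_of_norm_eq_one hu
    show χ (Q.pol s u) = (Q.twistB a (fun _ => false)).swap.pol (Q.σ s) u
    rw [twistB_swap_pol hu', planeSym_false_of_norm_eq_one _ hu]
    exact hC s u hu
  have hgerm₂ : ∀ s, Q₂.germ χ s =ᶠ[𝓝ˢ (Metric.sphere (0 : E2) 1)] (planeInv (a (Q.σ s)) ∘ Q.germ χ s) := by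
    intro s
    have hdom : IsOpen (Q.germDom χ s) := isOpen_germDom hk s
    have hsub : Metric.sphere (0 : E2) 1 ⊆ Q.germDom χ s := fun z hz => (germ_of_norm_eq_one hk hC s (by simpa using hz)).2
    apply Filter.eventuallyEq_of_mem (hdom.mem_nhdsSet.2 hsub)
    intro w hw
    show (Q.twistB a (fun _ => false)).swap.polInv (Q.σ s) (χ (Q.pol s w)) = planeInv (a (Q.σ s)) (Q.germ χ s w)
    rw [twistB_swap_polInv (k_swap_eq_one Q hk _) hw.2, germ_def, planeSym_def]
    congr 1
    ext i; fin_cases i <;> simp [planeRefl, boolSign]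
  have hpos₂ : ∀ s (z : E2), ‖z‖ = 1 → 0 < ⟪fderiv ℝ (Q₂.germ χ s) z z, z⟫ := by
    intro s z hz
    have hzs : z ∈ Metric.sphere (0 : E2) 1 := by simpa using hz
    have hdom : IsOpen (Q.germDom χ s) := isOpen_germDom hk s
    have hzdom : z ∈ Q.germDom χ s := (germ_of_norm_eq_one hk hC s hz).2
    have hD : HasFDerivAt (Q.germ χ s) (fderiv ℝ (Q.germ χ s) z) z :=
      (((contDiffOn_germ hk s).contDiffAt (hdom.mem_nhds hzdom)).differentiableAt (by simp)).hasFDerivAt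
    have hev : Q₂.germ χ s =ᶠ[𝓝 z] (planeInv (a (Q.σ s)) ∘ Q.germ χ s) := (hgerm₂ s).filter_mono (nhds_le_nhdsSet hzs)
    rw [hev.fderiv_eq]
    rcases germ_sign_dichotomy hk χ hC s with hsg | hsg
    · -- positive sign: no inversion
      have has : a (Q.σ s) = false := by
        cases h' : a (Q.σ s)
        · rfl
        · obtain ⟨z₀, hz₀⟩ : ∃ z₀ : E2, ‖z₀‖ = 1 := ⟨z, hz⟩
          exact absurd ((ha s).1 h' z₀ hz₀) (not_lt.2 (hsg z₀ hz₀).le)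
      rw [has]
      exact hsg z hz
    · -- negative sign: inversion, sign reversed
      rw [(ha s).2 hsg]
      have hfix : ∀ w : E2, ‖w‖ = 1 → Q.germ χ s w = w := fun w hw => (germ_of_norm_eq_one hk hC s hw).1
      obtain ⟨hcomp, hinner⟩ := inner_fderiv_circleInv_comp hfix hz hD
      have hfun : (planeInv true ∘ Q.germ χ s) = (circleInv ∘ Q.germ χ s) := funext fun w => by simp [planeInv, circleInv]
      rw [hfun, hcomp.fderiv, hinner]
      linarith [hsg z hz]
  -- Step 2: the normal straightening and the rigid remainder
  obtain ⟨Φ, hrig, hΦcirc, -⟩ := exists_rigid_of_normalStraighten (Q := Q₂) hk₂ hC₂ hpos₂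
  -- traces under `Φ₁` (it fixes them pointwise) and under the remainder
  have hΦfix : ∀ y, y ∈ P.B.traces → Φ.toDiffeomorph 1 y = y := by
    intro y hy
    obtain ⟨s', hs'⟩ := BasinSetting.mem_traces_iff_exists_traceOf.1 hy
    obtain ⟨s, rfl⟩ := Q.σ.surjective s'
    obtain ⟨u, hu, rfl⟩ := Q₂.swap.exists_eq_pol_of_mem_traceOf (k_swap_eq_one Q₂ hk₂ (Q.σ s)) hs'
    exact hΦcirc s u hu
  have hΦtr : ∀ y, Φ.toDiffeomorph 1 y ∈ P.B.traces ↔ y ∈ P.B.traces :=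
    mem_traces_iff_of_image_eq (Φ.toDiffeomorph 1).injective (fun y hy => by rw [hΦfix y hy]; exact hy)
      (fun y' hy' => ⟨y', hy', hΦfix y' hy'⟩)
  have hχ₂tr : ∀ y, (χ.trans (Φ.toDiffeomorph 1).symm) y ∈ P.B.traces ↔ y ∈ P.A.traces := fun y => by
    show (Φ.toDiffeomorph 1).symm (χ y) ∈ P.B.traces ↔ y ∈ P.A.traces
    rw [← hΦtr ((Φ.toDiffeomorph 1).symm (χ y)), (Φ.toDiffeomorph 1).apply_symm_apply]
    exact hχtr y
  -- Step 3: extend the pieces and compose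
  have hext₂ : (BoundaryManifold.boundaryData 2 W).DiffeoExtends (χ.trans (Φ.toDiffeomorph 1).symm) :=
    Q₂.diffeoExtends_of_forall_exists_rigid _ hχ₂tr hrig
  have hextΦ : (BoundaryManifold.boundaryData 2 W).DiffeoExtends (Φ.toDiffeomorph 1) :=
    BoundaryData.diffeoExtends_of_isDiffeotopicToId_holds 2 W _ _ (AmbientIsotopy.isDiffeotopicToId Φ 1)
  have hcomp : χ = (χ.trans (Φ.toDiffeomorph 1).symm).trans (Φ.toDiffeomorph 1) := by
    apply Diffeomorph.ext
    intro y
    exact ((Φ.toDiffeomorph 1).apply_symm_apply (χ y)).symm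
  rw [hcomp]
  exact hext₂.trans hextΦ

/-- **Extension of a boundary diffeomorphism permuting the trace circles whose circle maps are
isotopic to the identity**: straighten on the circles (`TraceCircleStraighten.lean`), extend the
remainder (`diffeoExtends_of_pol_eq_on_circles`) and the isotopy (collar theorem). [cite: GriffithsHB1964Handlebody, §§3–6] [cite: HirschDT1976, Ch. 8 §1 Thm. 1.3, §2] -/
theorem diffeoExtends_of_isIsotopic_refl (Q : P.SaddleData) (hk : ∀ s, (Q.DA s).k = 1)
    (χ : (𝓡∂ (2 + 1)).boundary W ≃ₘ⟮𝓡 2, 𝓡 2⟯ (𝓡∂ (2 + 1)).boundary W)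
    (hχ : ∀ s y, χ y ∈ P.B.traceOf (Q.σ s) ↔ y ∈ P.A.traceOf s)
    (hiso : ∀ s, Diffeomorph.IsIsotopic (Q.circleDiffeo hk χ hχ s) (Diffeomorph.refl (𝓡 1) (Metric.sphere (0 : E2) 1) ∞)) :
    (BoundaryManifold.boundaryData 2 W).DiffeoExtends χ := by
  obtain ⟨Ψ, hΨ1, -, -⟩ := exists_ambientIsotopy_circleStraighten (Q := Q) hk hχ hiso
  -- the straightened map `Ψ₁⁻¹ ∘ χ`
  have hC₁ : ∀ s (u : E2), ‖u‖ = 1 → (χ.trans (Ψ.toDiffeomorph 1).symm) (Q.pol s u) = Q.swap.pol (Q.σ s) u := by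
    intro s u hu
    show (Ψ.toDiffeomorph 1).symm (χ (Q.pol s u)) = Q.swap.pol (Q.σ s) u
    rw [← hΨ1 s ⟨u, by simpa using hu⟩]
    exact (Ψ.toDiffeomorph 1).symm_apply_apply _
  -- traces under `Ψ₁`
  have hΨtr : ∀ y, Ψ.toDiffeomorph 1 y ∈ P.B.traces ↔ y ∈ P.B.traces := by
    refine mem_traces_iff_of_image_eq (Ψ.toDiffeomorph 1).injective (fun y hy => ?_) (fun y' hy' => ?_)
    · obtain ⟨s', hs'⟩ := BasinSetting.mem_traces_iff_exists_traceOf.1 hy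
      obtain ⟨s, rfl⟩ := Q.σ.surjective s'
      obtain ⟨u, hu, rfl⟩ := Q.swap.exists_eq_pol_of_mem_traceOf (k_swap_eq_one Q hk (Q.σ s)) hs'
      show Ψ.toFun 1 (Q.swap.pol (Q.σ s) u) ∈ P.B.traces
      rw [hΨ1 s ⟨u, by simpa using hu⟩]
      exact BasinSetting.mem_traces_of_mem_traceOf ((hχ s _).2 (Q.pol_mem_traceOf (hk s) hu))
    · obtain ⟨s', hs'⟩ := BasinSetting.mem_traces_iff_exists_traceOf.1 hy'
      obtain ⟨s, rfl⟩ := Q.σ.surjective s'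
      have h1 : χ.symm y' ∈ P.A.traceOf s := (symm_mem_traceOf_iff Q χ hχ s y').2 hs'
      obtain ⟨u, hu, hu'⟩ := Q.exists_eq_pol_of_mem_traceOf (hk s) h1
      refine ⟨Q.swap.pol (Q.σ s) u, BasinSetting.mem_traces_of_mem_traceOf (Q.swap.pol_mem_traceOf (k_swap_eq_one Q hk _) hu), ?_⟩
      show Ψ.toFun 1 (Q.swap.pol (Q.σ s) u) = y'
      rw [hΨ1 s ⟨u, by simpa using hu⟩]
      show χ (Q.pol s u) = y'
      rw [hu', χ.apply_symm_apply]
  have hχ₁tr : ∀ y, (χ.trans (Ψ.toDiffeomorph 1).symm) y ∈ P.B.traces ↔ y ∈ P.A.traces := fun y => by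
    show (Ψ.toDiffeomorph 1).symm (χ y) ∈ P.B.traces ↔ y ∈ P.A.traces
    rw [← hΨtr ((Ψ.toDiffeomorph 1).symm (χ y)), (Ψ.toDiffeomorph 1).apply_symm_apply]
    exact mem_traces_iff_of_traceOf Q hχ y
  have hext₁ := diffeoExtends_of_pol_eq_on_circles Q hk (χ.trans (Ψ.toDiffeomorph 1).symm) hC₁ hχ₁tr
  have hextΨ : (BoundaryManifold.boundaryData 2 W).DiffeoExtends (Ψ.toDiffeomorph 1) :=
    BoundaryData.diffeoExtends_of_isDiffeotopicToId_holds 2 W _ _ (AmbientIsotopy.isDiffeotopicToId Ψ 1)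
  have hcomp : χ = (χ.trans (Ψ.toDiffeomorph 1).symm).trans (Ψ.toDiffeomorph 1) := by
    apply Diffeomorph.ext
    intro y
    exact ((Ψ.toDiffeomorph 1).apply_symm_apply (χ y)).symm
  rw [hcomp]
  exact hext₁.trans hextΨ

/-- **Boundary diffeomorphisms permuting the trace circles of the saddles extend** (dimension
`3`, all saddles of index `1`).  Let `P` be a pair of basin settings on a compact `3`-manifold
with boundary `W` and `Q` saddle data for `P` all of whose boxes have index `1`.  Every
diffeomorphism `χ` of `∂W` such that, for every saddle `s`, `χ` carries the `ξ_A`-trace circle of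
`s` onto the `ξ_B`-trace circle of `σ s`, extends to a diffeomorphism of `W`. [cite: GriffithsHB1964Handlebody, §§3–6] [cite: HirschDT1976, Ch. 8 §1 Thm. 1.3, §3 Thm. 3.3] -/
theorem diffeoExtends_of_traceOf (Q : P.SaddleData) (hk : ∀ s, (Q.DA s).k = 1)
    (χ : (𝓡∂ (2 + 1)).boundary W ≃ₘ⟮𝓡 2, 𝓡 2⟯ (𝓡∂ (2 + 1)).boundary W)
    (hχ : ∀ s y, χ y ∈ P.B.traceOf (Q.σ s) ↔ y ∈ P.A.traceOf s) :
    (BoundaryManifold.boundaryData 2 W).DiffeoExtends χ := by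
  obtain ⟨b, hb⟩ := exists_twistB_isIsotopic_refl (Q := Q) hk χ hχ
  exact diffeoExtends_of_isIsotopic_refl (Q.twistB (fun _ => false) b) (hk_twistB hk (fun _ => false) b) χ hχ hb

end SaddleData

end BasinPair

end Literature.Topology.FourManifolds
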